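import Mathlib
import Literature.Probability.Percolation.DiagonalStripTransferAtZero
import Literature.Probability.Percolation.DiagonalStripCharacterRecursion
import HarnessLib

/-!
# The relative pair bound of the ground state

Topic `Literature/Probability/Percolation`. For the primitive polynomial ground state `P` of IP12's
transfer matrix (Ikhlef–Ponsaing, J. Stat. Phys. 149 (2012), arXiv:1202.5476), with bottom twist
`a` (`ι_1 P_Q = z_1^{2a} P_Q`, so `P_Q` is `z_1`-palindromic of formal degree `D_z = -2a`), we
prove the **relative pair bound** `s_1 + s_2 + 2 ≤ 2 D_z` for every monomial `z⃗^s` of every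
component (**`IsGroundState.pair_rel`**). Proof: the top bidegree slice
`c_Q := [z_2^{D_z}][z_1^{D_z}] P_Q` is `e_1`-fixed (`c_Q = Σ_{lump(e_1 Q₀) = Q} c_{Q₀}`, the top
bidegree of the level-`1` exchange relation (20), **`IsGroundState.topSlice_fixed`**), hence
supported on wall-connected patterns, where it vanishes: by palindromicity the top `z_1`-slice is
the value at `z_1 = 0` (**`uCoeff_top_eq_substHom_of_revPoly`**), which is zero on wall-connected
components (`DiagonalStripTransferAtZero`). Combined with the degree input `D_z ≤ 4m` this is the
pair bound `s_1 + s_2 ≤ 8m - 2` of IP12 §4.1 used in the sum rule.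

## References

* Y. Ikhlef, A. K. Ponsaing, *Finite-size left-passage probability in percolation*, J. Stat. Phys.
  149 (2012) 10–36, arXiv:1202.5476, §3.4 (20), §4.1. [IkhlefPonsaing2012]
-/

namespace Literature.Probability.Percolation

open Finset Literature.Probability.LatticeModels

/-! ## (Y4) The relative pair bound -/

section RelativePair

open MvPolynomial

variable {K₀ : Type*} [Field K₀]

/-- `uCoeff i 0 F = F(X_i := 0)`. [folklore] -/
theorem uCoeff_zero_eq_substHom (i : ℕ) (F : MvPolynomial ℕ K₀) : uCoeff K₀ i 0 F = substHom i 0 F := by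
  conv_rhs => rw [eq_sum_X_pow_mul_uCoeff i F (Nat.lt_succ_self _)]
  rw [map_sum, Finset.sum_eq_single 0]
  · rw [map_mul, pow_zero, map_one, one_mul, substHom_eq_self_of_degreeOf_eq_zero i 0 (degreeOf_uCoeff_self i 0 F)]
  · intro d _ hd
    rw [map_mul, map_pow, substHom_X_self, zero_pow hd, zero_mul]
  · intro h; exact absurd (Finset.mem_range.2 (Nat.succ_pos _)) h

/-- `uCoeff` of a negation. [folklore] -/
theorem uCoeff_neg (i d : ℕ) (F : MvPolynomial ℕ K₀) : uCoeff K₀ i d (-F) = -uCoeff K₀ i d F := by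
  have := uCoeff_add i d F (-F)
  rw [add_neg_cancel] at this
  have h0 : uCoeff K₀ i d (0 : MvPolynomial ℕ K₀) = 0 := by
    classical
    simp [uCoeff]
  rw [h0] at this
  linear_combination -this

/-- `uCoeff` of a difference. [folklore] -/
theorem uCoeff_sub (i d : ℕ) (F G : MvPolynomial ℕ K₀) : uCoeff K₀ i d (F - G) = uCoeff K₀ i d F - uCoeff K₀ i d G := by
  rw [sub_eq_add_neg, uCoeff_add, uCoeff_neg, ← sub_eq_add_neg]

/-- `uCoeff` through a left factor free of `X_i`. [folklore] -/
theorem uCoeff_mul_left_of_degreeOf_eq_zero (i d : ℕ) {g : MvPolynomial ℕ K₀} (hg : g.degreeOf i = 0) (f : MvPolynomial ℕ K₀) :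
    uCoeff K₀ i d (g * f) = g * uCoeff K₀ i d f := by
  rw [mul_comm, uCoeff_mul_of_degreeOf_eq_zero i d f hg, mul_comm]

/-- `uCoeff` through a constant. [folklore] -/
theorem uCoeff_C_mul (i d : ℕ) (c : K₀) (f : MvPolynomial ℕ K₀) : uCoeff K₀ i d (C c * f) = C c * uCoeff K₀ i d f :=
  uCoeff_mul_left_of_degreeOf_eq_zero i d (degreeOf_C c i) f

/-- **Shift**: `[X_i^{d+k}] (X_i^k F) = [X_i^d] F`. [folklore] -/
theorem uCoeff_X_pow_mul (i d k : ℕ) (F : MvPolynomial ℕ K₀) : uCoeff K₀ i (d + k) (X i ^ k * F) = uCoeff K₀ i d F := by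
  apply toRF_injective
  rw [← coeff_rapUni_eq, ← coeff_rapUni_eq, map_mul, map_pow, rapUni_X_self, mul_comm, Polynomial.coeff_mul_X_pow]

/-- `[X_i^{e}] (X_i^k F) = 0` for `e < k`. [folklore] -/
theorem uCoeff_X_pow_mul_of_lt {i e k : ℕ} (hek : e < k) (F : MvPolynomial ℕ K₀) : uCoeff K₀ i e (X i ^ k * F) = 0 := by
  apply toRF_injective
  rw [← coeff_rapUni_eq, map_mul, map_pow, rapUni_X_self, mul_comm, Polynomial.coeff_mul_X_pow', if_neg (not_le.2 hek),
    map_zero]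

/-- **Bivariate top slices and the swap**: `[X_{u+1}^e][X_u^d] (swap F) = [X_{u+1}^d][X_u^e] F`. [folklore] -/
theorem uCoeff_uCoeff_rename_swap (u d e : ℕ) (F : MvPolynomial ℕ K₀) :
    uCoeff K₀ (u + 1) e (uCoeff K₀ u d (rename (Equiv.swap u (u + 1)) F)) = uCoeff K₀ (u + 1) d (uCoeff K₀ u e F) := by
  classical
  ext t
  by_cases ht : t u = 0 ∧ t (u + 1) = 0
  · rw [coeff_uCoeff_uCoeff _ _ _ _ _ ht.1 ht.2, coeff_uCoeff_uCoeff _ _ _ _ _ ht.1 ht.2]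
    have hmapt : Finsupp.mapDomain (Equiv.swap u (u + 1)) t = t := by
      refine Finsupp.ext fun k => ?_
      by_cases hk : k = u
      · have := Finsupp.mapDomain_apply (Equiv.swap u (u + 1)).injective t (u + 1)
        rw [Equiv.swap_apply_right] at this
        rw [hk, this, ht.1, ht.2]
      · by_cases hk1 : k = u + 1
        · have := Finsupp.mapDomain_apply (Equiv.swap u (u + 1)).injective t u
          rw [Equiv.swap_apply_left] at this
          rw [hk1, this, ht.1, ht.2]
        · have := Finsupp.mapDomain_apply (Equiv.swap u (u + 1)).injective t k
          rwa [Equiv.swap_apply_of_ne_of_ne hk hk1] at this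
    have hmap : Finsupp.mapDomain (Equiv.swap u (u + 1)) (t + Finsupp.single (u + 1) d + Finsupp.single u e) =
        t + Finsupp.single (u + 1) e + Finsupp.single u d := by
      rw [Finsupp.mapDomain_add, Finsupp.mapDomain_add, Finsupp.mapDomain_single, Finsupp.mapDomain_single, hmapt,
        Equiv.swap_apply_right, Equiv.swap_apply_left, add_assoc, add_comm (Finsupp.single u d), ← add_assoc]
    rw [← hmap, coeff_rename_mapDomain _ (Equiv.swap u (u + 1)).injective]
  · -- both sides vanish off `t u = t (u+1) = 0`
    have key : ∀ G : MvPolynomial ℕ K₀, ∀ d' e', coeff t (uCoeff K₀ (u + 1) e' (uCoeff K₀ u d' G)) = 0 := by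
      intro G d' e'
      rcases not_and_or.1 ht with h1 | h1
      · exact coeff_eq_zero_of_degreeOf_eq_zero (degreeOf_uCoeff_eq_zero (degreeOf_uCoeff_self u d' G)) h1
      · exact coeff_eq_zero_of_degreeOf_eq_zero (degreeOf_uCoeff_self (u + 1) e' _) h1
    rw [key, key]

/-- **The top `X_k`-slice of an `X_k`-palindromic polynomial is its value at `X_k = 0`.** [folklore] -/
theorem uCoeff_top_eq_substHom_of_revPoly {k D : ℕ} {F : MvPolynomial ℕ K₀} (hdeg : F.degreeOf k ≤ D) (hpal : revPoly k D F = F) :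
    uCoeff K₀ k D F = substHom k 0 F := by
  classical
  rw [← uCoeff_zero_eq_substHom]
  ext t
  by_cases ht : t k = 0
  · rw [coeff_uCoeff _ _ _ _ ht, coeff_uCoeff _ _ _ _ ht, Finsupp.single_zero, add_zero]
    conv_lhs => rw [← hpal]
    rw [coeff_revPoly hdeg (by simp [ht])]
    congr 1
    ext j
    by_cases hj : j = k
    · subst hj; rw [revExp_apply_self]; simp [ht]
    · rw [revExp_apply_of_ne _ hj]; simp [Ne.symm hj]
  · rw [coeff_eq_zero_of_degreeOf_eq_zero (degreeOf_uCoeff_self k D F) ht,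
      coeff_eq_zero_of_degreeOf_eq_zero (degreeOf_uCoeff_self k 0 F) ht]

variable {n : ℕ} {q : ℂ}

/-- Joining the two bottom sites of a valid even pattern gives a wall-connected lumped pattern
(width `≥ 1`). [folklore] -/
theorem wallConn_lump_cpJoin {Q₀ : ColPattern (n + 1)} (hQ₀ : IsValid 0 Q₀) :
    WallConn (lump (cpJoin (Fin.castSucc (0 : Fin (n + 1))) (0 : Fin (n + 1)).succ Q₀)) := by
  refine ⟨(0 : Fin (n + 1)).succ, Fin.succ_ne_zero _, ?_⟩
  rw [lump_snd]
  simp [cpJoin, hQ₀.refl, hQ₀.bottom]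

namespace IsGroundState

variable {P : ColPattern (n + 1) → MvPolynomial ℕ ℂ} {a : ℤ}

/-- Some component of the primitive ground state is nonzero. [folklore] -/
theorem exists_ne_zero (h : IsGroundState (n + 1) q P a) : ∃ Q, P Q ≠ 0 := by
  by_contra hall
  push Not at hall
  have := h.prim 0 fun Q => by rw [hall Q]
  exact not_isUnit_zero this

/-- **The twist is nonpositive.** [folklore] -/
theorem twist_le_zero (h : IsGroundState (n + 1) q P a) : a ≤ 0 := by
  obtain ⟨Q, hQ⟩ := h.exists_ne_zero
  have := twist_nonpos hQ (h.bot Q)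
  omega

/-- The formal `z_1`-degree `D_z = -2a` of the components. [folklore] -/
theorem bot_pow (h : IsGroundState (n + 1) q P a) (Q : ColPattern (n + 1)) :
    genInv ℂ 1 (toRF ℂ (P Q)) * genZ ℂ 1 ^ (2 * (-a)).toNat = toRF ℂ (P Q) := by
  have ha := h.twist_le_zero
  rw [h.bot Q, mul_assoc, mul_comm (toRF ℂ (P Q)), ← mul_assoc, ← zpow_natCast, ← zpow_add₀ (genZ_ne_zero 1),
    Int.toNat_of_nonneg (by omega)]
  have : (2 * a + 2 * -a : ℤ) = 0 := by ring
  rw [this, zpow_zero, one_mul]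

/-- `deg_{z_1} P_Q ≤ D_z`. [folklore] -/
theorem degreeOf_one_le' (h : IsGroundState (n + 1) q P a) (Q : ColPattern (n + 1)) :
    (P Q).degreeOf 1 ≤ (2 * (-a)).toNat :=
  degreeOf_le_of_genInv_mul_pow (h.bot_pow Q)

/-- `deg_{z_2} P_Q ≤ D_z` (exchange relation at level `1`). [folklore] -/
theorem degreeOf_two_le' (hq : q ^ 2 + q + 1 = 0) (h : IsGroundState (n + 1) q P a) (Q : ColPattern (n + 1)) :
    (P Q).degreeOf 2 ≤ (2 * (-a)).toNat := by
  have := degreeOf_succ_le_of_exactExchange hq (h.odd 0) (fun Q => h.degreeOf_one_le' Q) Q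
  simpa using this

/-- The components are `z_1`-palindromic of formal degree `D_z`. [folklore] -/
theorem revPoly_one (h : IsGroundState (n + 1) q P a) (Q : ColPattern (n + 1)) :
    revPoly 1 (2 * (-a)).toNat (P Q) = P Q :=
  revPoly_eq_self_of_genInv (h.degreeOf_one_le' Q) (h.bot_pow Q)

/-- **The top `z_1`-slice vanishes on wall-connected components.** [cite: IkhlefPonsaing2012, §4.1] -/
theorem uCoeff_one_top_eq_zero (hq : q ^ 2 + q + 1 = 0) (h : IsGroundState (n + 1) q P a) {Q : ColPattern (n + 1)}
    (hW : WallConn Q) : uCoeff ℂ 1 (2 * (-a)).toNat (P Q) = 0 := by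
  rw [uCoeff_top_eq_substHom_of_revPoly (h.degreeOf_one_le' Q) (h.revPoly_one Q), h.substHom_one_zero_eq_zero hq hW]

/-- **The top bidegree slice `c_Q := [X_2^{D_z}][X_1^{D_z}] P_Q` is `e_1`-fixed**:
`c_Q = Σ_{lump (e_1 Q₀) = Q} c_{Q₀}` (top bidegree of the level-`1` exchange relation).
[cite: IkhlefPonsaing2012, §3.4 (20)] -/
theorem topSlice_fixed (hq : q ^ 2 + q + 1 = 0) (h : IsGroundState (n + 1) q P a) (Q : ColPattern (n + 1)) :
    uCoeff ℂ 2 (2 * (-a)).toNat (uCoeff ℂ 1 (2 * (-a)).toNat (P Q)) =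
      ∑ Q₀ ∈ Finset.univ.filter (fun Q₀ => lump (cpJoin (Fin.castSucc (0 : Fin (n + 1))) (0 : Fin (n + 1)).succ Q₀) = Q),
        uCoeff ℂ 2 (2 * (-a)).toNat (uCoeff ℂ 1 (2 * (-a)).toNat (P Q₀)) := by
  classical
  set D := (2 * (-a)).toNat with hD
  have hq0 : q ≠ 0 := q_ne_zero_of_quad hq
  have hex := exactExchange_poly hq (h.odd 0) Q
  simp only [Fin.val_zero, mul_zero, zero_add] at hex
  -- apply `[X_2^D][X_1^{D+2}]` to the exchange relation
  have hT := congrArg (fun F => uCoeff ℂ 2 D (uCoeff ℂ 1 (D + 2) F)) hex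
  set E := ∑ Q₀ ∈ Finset.univ.filter (fun Q₀ => lump (cpJoin (Fin.castSucc (0 : Fin (n + 1))) (0 : Fin (n + 1)).succ Q₀) = Q), P Q₀
    with hE
  have hdeg1 : ∀ R, (P R).degreeOf 1 < D + 2 := fun R => by have := h.degreeOf_one_le' R; omega
  have hdegE : E.degreeOf 1 < D + 2 := by
    refine lt_of_le_of_lt (degreeOf_sum_le _ _ _) ?_
    exact (Finset.sup_lt_iff (by simp)).2 fun R _ => hdeg1 R
  have hdegσ : (rename (Equiv.swap 1 (1 + 1)) (P Q)).degreeOf 1 < D + 2 := by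
    have hr := degreeOf_rename_of_injective (Equiv.swap 1 (1 + 1)).injective (1 + 1) (p := P Q)
    rw [Equiv.swap_apply_right] at hr
    rw [hr]
    have := h.degreeOf_two_le' hq Q
    simp only [Nat.reduceAdd] at this ⊢; omega
  have hX2 : (X 2 : MvPolynomial ℕ ℂ).degreeOf 1 = 0 := by rw [degreeOf_X_of_ne]; decide
  have hX2sq : ((X 2 : MvPolynomial ℕ ℂ) ^ 2).degreeOf 1 = 0 := by
    apply Nat.eq_zero_of_le_zero; refine (degreeOf_pow_le _ _ _).trans ?_; rw [hX2]
  -- evaluate the left-hand side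
  have hL1 : uCoeff ℂ 1 (D + 2) ((C (q ^ 2) * X (1 + 1) ^ 2 - X 1 ^ 2) * P Q) = -uCoeff ℂ 1 D (P Q) := by
    rw [sub_mul, uCoeff_sub, mul_assoc, uCoeff_C_mul, show (1 + 1 : ℕ) = 2 from rfl,
      uCoeff_mul_left_of_degreeOf_eq_zero _ _ hX2sq, uCoeff_eq_zero_of_lt (hdeg1 Q), mul_zero, mul_zero, zero_sub,
      uCoeff_X_pow_mul]
  have hL2 : uCoeff ℂ 1 (D + 2) (C q * (X 1 ^ 2 - X (1 + 1) ^ 2) * E) = C q * uCoeff ℂ 1 D E := by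
    rw [mul_assoc, uCoeff_C_mul, sub_mul, uCoeff_sub, uCoeff_X_pow_mul, show (1 + 1 : ℕ) = 2 from rfl,
      uCoeff_mul_left_of_degreeOf_eq_zero _ _ hX2sq, uCoeff_eq_zero_of_lt hdegE, mul_zero, sub_zero]
  have hR : uCoeff ℂ 1 (D + 2) ((C (q ^ 2) * X 1 ^ 2 - X (1 + 1) ^ 2) * rename (Equiv.swap 1 (1 + 1)) (P Q)) =
      C (q ^ 2) * uCoeff ℂ 1 D (rename (Equiv.swap 1 (1 + 1)) (P Q)) := by
    rw [sub_mul, uCoeff_sub, mul_assoc, uCoeff_C_mul, uCoeff_X_pow_mul, show (1 + 1 : ℕ) = 2 from rfl,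
      uCoeff_mul_left_of_degreeOf_eq_zero _ _ hX2sq]
    rw [show (2 : ℕ) = 1 + 1 from rfl, uCoeff_eq_zero_of_lt hdegσ, mul_zero, sub_zero]
  rw [uCoeff_sub, hL1, hL2, hR] at hT
  rw [uCoeff_sub, uCoeff_neg, uCoeff_C_mul, uCoeff_C_mul] at hT
  have hswap := uCoeff_uCoeff_rename_swap (K₀ := ℂ) 1 D D (P Q)
  simp only [Nat.reduceAdd] at hT hswap
  rw [hswap] at hT
  -- `-c - q ĉ = q² c`, i.e. `ĉ = c`
  have hC : (C q : MvPolynomial ℕ ℂ) ^ 2 + C q + 1 = 0 := by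
    rw [← C_pow, ← C_1, ← C_add, ← C_add, hq, C_0]
  rw [hE, uCoeff_finset_sum, uCoeff_finset_sum] at hT
  have hCq : (C q : MvPolynomial ℕ ℂ) ≠ 0 := (map_ne_zero_iff C (C_injective ℕ ℂ)).2 hq0
  apply mul_left_cancel₀ hCq
  rw [C_pow] at hT
  linear_combination hT + (uCoeff ℂ 2 D (uCoeff ℂ 1 D (P Q))) * hC

/-- **The top bidegree slice vanishes**: no component contains the monomial `z_1^{D_z} z_2^{D_z} · …`.
[cite: IkhlefPonsaing2012, §4.1] -/
theorem topSlice_eq_zero (hq : q ^ 2 + q + 1 = 0) (h : IsGroundState (n + 1) q P a) (Q : ColPattern (n + 1)) :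
    uCoeff ℂ 2 (2 * (-a)).toNat (uCoeff ℂ 1 (2 * (-a)).toNat (P Q)) = 0 := by
  classical
  by_cases hW : WallConn Q
  · rw [h.uCoeff_one_top_eq_zero hq hW]; simp [uCoeff]
  · rw [h.topSlice_fixed hq Q]
    refine Finset.sum_eq_zero fun Q₀ hQ₀ => ?_
    rw [Finset.mem_filter] at hQ₀
    by_cases hP : P Q₀ = 0
    · rw [hP]; simp [uCoeff]
    · exfalso
      obtain ⟨hv, -, -⟩ := h.supp hq Q₀ (fun h0 => hP (toRF_injective (by rw [h0, map_zero])))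
      exact hW (hQ₀.2 ▸ wallConn_lump_cpJoin hv)

/-- **The relative pair bound**: every monomial `z⃗^s` of a component satisfies
`s_1 + s_2 + 2 ≤ 2 D_z` (`D_z = -2a` the formal `z_1`-degree). [cite: IkhlefPonsaing2012, §4.1] -/
theorem pair_rel (hq : q ^ 2 + q + 1 = 0) (h : IsGroundState (n + 1) q P a) (Q : ColPattern (n + 1)) {s : ℕ →₀ ℕ}
    (hs : s ∈ (P Q).support) : s 1 + s 2 + 2 ≤ 2 * (2 * (-a)).toNat := by
  classical
  set D := (2 * (-a)).toNat with hD
  have h1 : s 1 ≤ D := (monomial_le_degreeOf 1 hs).trans (h.degreeOf_one_le' Q)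
  have h2 : s 2 ≤ D := (monomial_le_degreeOf 2 hs).trans (h.degreeOf_two_le' hq Q)
  have hne : ¬ (s 1 = D ∧ s 2 = D) := by
    rintro ⟨hs1, hs2⟩
    have hc := h.topSlice_eq_zero hq Q
    have ht := congrArg (coeff ((s.erase 1).erase 2)) hc
    rw [coeff_zero, show (2 : ℕ) = 1 + 1 from rfl, coeff_uCoeff_uCoeff _ _ _ _ _ (by simp) (by simp)] at ht
    have hs' : (s.erase 1).erase (1 + 1) + Finsupp.single (1 + 1) D + Finsupp.single 1 D = s := by
      ext k
      simp only [Finsupp.add_apply, Finsupp.erase_apply, Finsupp.single_apply, Nat.reduceAdd]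
      by_cases hk1 : k = 1
      · subst hk1; simp [hs1]
      · by_cases hk2 : k = 2
        · subst hk2; simp [hs2]
        · simp [hk1, hk2, Ne.symm hk1, Ne.symm hk2]
    rw [hs'] at ht
    exact (mem_support_iff.1 hs) ht
  have he1 : Even (s 1) := h.even_exponent hq Q hs 1
  have he2 : Even (s 2) := h.even_exponent hq Q hs 2
  have hDe : Even D := by rw [hD]; exact ⟨(-a).toNat, by omega⟩
  obtain ⟨x, hx⟩ := he1; obtain ⟨y, hy⟩ := he2; obtain ⟨z, hz⟩ := hDe
  omega

end IsGroundState

end RelativePair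

end Literature.Probability.Percolation
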